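import Summits.Schanuel.Schanuel.Theorems.ZilberEacMonicCurvePolyFibres
import Summits.Schanuel.Schanuel.Theorems.ZilberEacFermatBaseFamily
import Summits.Schanuel.Schanuel.Theorems.ZilberEacEllipticBaseExample
import HarnessLib

/-!
# Arbitrary base branches, LV: EVERY polynomial fibre over EVERY Fermat curve `x₀ⁿ + x₁ⁿ = 1`
# (`n ≥ 2`; the complex circle included) and over the genus-one curve `x₁² − x₀²x₁ = 1` — case ∧ dense

HONEST FRAMING.  Cell `pub-schanuel` (Zilber's Exponential-Algebraic Closedness, case ladder;
host summit Schanuel), seat 2, gen 30.  File XVII (gen 28) decided the graph fibres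
`y₀ = x₁ − ζx₀ + θ` over the Fermat curves; file LIV (this generation) needs only a monic irreducible
equation, a place at infinity and a good direction.  For `F_n : x₀ⁿ + x₁ⁿ = 1` the rows
`x₁ⁿ + (x₀ⁿ − 1)` are monic irreducible (XVII), the place `x₀ = 1/s`, `x₁ = ζ(1 − sⁿ)^{1/n}/s`
(`ζⁿ = −1`) has `(k, M) = (1, 1)` and direction `Re(ζ·2πi) = −2π·Im ζ ≠ 0` for `ζ = e^{iπ/n}`.
Hence **`unprojectedDensityQuestion_fermatCurve_polyFibre`**: for every `n ≥ 2` and EVERY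
`R ∈ ℂ[x₀, x₁]` nonzero somewhere on `F_n`, `{x₀ⁿ + x₁ⁿ − 1 = 0, y₀ = R(x₀, x₁)}` is in
Mantova–Masser's case AND has Zariski-dense exponential points; examples
`{x₀² + x₁² = 1, y₀ = x₀x₁}` (the complex circle) and `{x₀³ + x₁³ = 1, y₀ = x₀ + x₁}`.  The same
engine over the genus-one base of gen 28 (file XII), `x₁² − x₀²x₁ = 1` with its place `x₀ = 1/s`,
`x₁ = Φ(s)/s²` (`(k, M) = (1, 2)`, direction `Re (2πi)² = −4π² ≠ 0`):
**`unprojectedDensityQuestion_genusOne_polyFibre`** — every polynomial fibre nonzero somewhere on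
the curve is case ∧ dense (e.g. `y₀ = x₀x₁`).
Decided instances of an OPEN question (Mantova–Masser, PLMS 2024 §1 p. 5); EC(3,2) OPEN; NOT
Schanuel's conjecture (neither used nor implied); EAC ⇏ SC.
-/

noncomputable section

open Filter Topology Set Complex Polynomial
open Literature.NumberTheory.Transcendental Literature.ModelTheory.Zilber
open Literature.ModelTheory.ExponentialFields

set_option linter.dupNamespace false

namespace Summit.Schanuel.Schanuel.Theorems

section FermatCurve

variable (n : ℕ)

/-- A non-real `n`-th root of `−1` (`n ≥ 2`): `ζ = e^{iπ/n}`. [folklore] -/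
theorem exists_pow_eq_neg_one_im_ne_zero (hn : 2 ≤ n) : ∃ ζ : ℂ, ζ ^ n = -1 ∧ ζ.im ≠ 0 := by
  have hnC : (n : ℂ) ≠ 0 := Nat.cast_ne_zero.2 (by omega)
  have hnR : (0 : ℝ) < n := by exact_mod_cast (by omega : 0 < n)
  refine ⟨Complex.exp (((Real.pi / n : ℝ) : ℂ) * I), ?_, ?_⟩
  · rw [← Complex.exp_nat_mul, show ((n : ℕ) : ℂ) * ((((Real.pi / n : ℝ)) : ℂ) * I) = Real.pi * I by
      push_cast; field_simp, Complex.exp_pi_mul_I]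
  · rw [Complex.exp_ofReal_mul_I_im]
    have h2 : (2 : ℝ) ≤ n := by exact_mod_cast hn
    refine (Real.sin_pos_of_pos_of_lt_pi (by positivity) ?_).ne'
    rw [div_lt_iff₀ hnR]
    nlinarith [Real.pi_pos]

/-- The rows of the Fermat curve evaluate to `yⁿ + (xⁿ − 1)`. -/
theorem eval_fermat_rows (x y : ℂ) :
    ((Polynomial.X ^ n + Polynomial.C (Polynomial.X ^ n - 1 : ℂ[X])).map
        (Polynomial.evalRingHom x)).eval y = y ^ n + (x ^ n - 1) := by
  simp

/-- **The place at infinity of the Fermat curve** in the cell's chart: `x₀ = s^{-1}`,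
`x₁ = Φ(s)s^{-1}` with `Φ(s) = ζ(1 − sⁿ)^{1/n}`, `Φ(0) = ζ` (`ζⁿ = −1`). [folklore] -/
theorem fermat_place (hn : 1 ≤ n) {ζ : ℂ} (hζ : ζ ^ n = -1) :
    ∃ Φ : ℂ → ℂ, AnalyticAt ℂ Φ 0 ∧ Φ 0 = ζ ∧
      ∀ᶠ s in 𝓝[≠] (0 : ℂ),
        ((Polynomial.X ^ n + Polynomial.C (Polynomial.X ^ n - 1 : ℂ[X])).map
          (Polynomial.evalRingHom (s ^ 1)⁻¹)).eval (Φ s * (s ^ 1)⁻¹) = 0 := by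
  obtain ⟨q, -, hqan, -, hq0, -, hqn⟩ := fermat_branch_facts n hn
  have hpow : AnalyticAt ℂ (fun s : ℂ => s ^ n) 0 := analyticAt_id.pow n
  have hcomp : AnalyticAt ℂ (fun s : ℂ => q (s ^ n)) 0 :=
    AnalyticAt.comp_of_eq (f := fun s : ℂ => s ^ n) hqan hpow (by simp [zero_pow (by omega : n ≠ 0)])
  refine ⟨fun s => ζ * q (s ^ n), analyticAt_const.mul hcomp, by
    simp only [zero_pow (by omega : n ≠ 0), hq0, mul_one], ?_⟩
  have hqn' : ∀ᶠ s in 𝓝 (0 : ℂ), q (s ^ n) ^ n = 1 - s ^ n := by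
    have ht : Tendsto (fun s : ℂ => s ^ n) (𝓝 (0 : ℂ)) (𝓝 0) := by
      have := hpow.continuousAt.tendsto
      rwa [zero_pow (by omega)] at this
    exact ht.eventually hqn
  filter_upwards [eventually_nhdsWithin_of_eventually_nhds hqn', self_mem_nhdsWithin] with s hs hs0
  have hs0' : s ≠ 0 := hs0
  rw [eval_fermat_rows, pow_one, mul_pow, mul_pow, hζ, hs, inv_pow]
  field_simp
  ring

/-- **Mantova–Masser's question for EVERY polynomial fibre over EVERY Fermat curve: case ∧ dense.**
`n ≥ 2`; `R ∈ ℂ[x₀, x₁]` nonzero at some point of `x₀ⁿ + x₁ⁿ = 1`: `{x₀ⁿ + x₁ⁿ − 1 = 0,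
y₀ = R(x₀, x₁)}` is in Mantova–Masser's case AND has Zariski-dense exponential points.
[cite: MantovaMasser2023, §1 Further remarks, p. 5 (the question, open in general)] (new) -/
theorem unprojectedDensityQuestion_fermatCurve_polyFibre (hn : 2 ≤ n) (R : MvPolynomial (Fin 2) ℂ)
    (hR : ∃ x y : ℂ, x ^ n + y ^ n - 1 = 0 ∧ MvPolynomial.eval ![x, y] R ≠ 0) :
    MMCaseDimPiOneFree {w : Fin 2 ⊕ Fin 2 → ℂ |
        w (Sum.inl 0) ^ n + w (Sum.inl 1) ^ n - 1 = 0 ∧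
        w (Sum.inr 0) = MvPolynomial.eval ![w (Sum.inl 0), w (Sum.inl 1)] R} ∧
      UnprojectedDense {w : Fin 2 ⊕ Fin 2 → ℂ |
        w (Sum.inl 0) ^ n + w (Sum.inl 1) ^ n - 1 = 0 ∧
        w (Sum.inr 0) = MvPolynomial.eval ![w (Sum.inl 0), w (Sum.inl 1)] R} := by
  set F : ℂ[X][X] := Polynomial.X ^ n + Polynomial.C (Polynomial.X ^ n - 1 : ℂ[X]) with hFdef
  have hFm : F.Monic := Polynomial.monic_X_pow_add_C _ (by omega)
  have hFdeg : F.natDegree = n := Polynomial.natDegree_X_pow_add_C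
  have hFirr : Irreducible F := irreducible_fermat_row n (by omega)
  obtain ⟨ζ, hζ, hζim⟩ := exists_pow_eq_neg_one_im_ne_zero n hn
  obtain ⟨Φ, hΦan, hΦ0, hplace⟩ := fermat_place n (by omega) hζ
  have hdir : ∃ z : ℂ, z ^ 1 = 2 * Real.pi * I ∧ (Φ 0 * z ^ 1).re ≠ 0 := by
    refine ⟨2 * Real.pi * I, pow_one _, ?_⟩
    rw [pow_one, hΦ0]
    have h : (ζ * (2 * Real.pi * I)).re = -(2 * Real.pi * ζ.im) := by
      simp [Complex.mul_re, Complex.mul_im]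
      ring
    rw [h, neg_ne_zero]
    exact mul_ne_zero (mul_ne_zero two_ne_zero Real.pi_ne_zero) hζim
  have e : {w : Fin 2 ⊕ Fin 2 → ℂ |
        (F.map (Polynomial.evalRingHom (w (Sum.inl 0)))).eval (w (Sum.inl 1)) = 0 ∧
        w (Sum.inr 0) = MvPolynomial.eval ![w (Sum.inl 0), w (Sum.inl 1)] R} =
      {w : Fin 2 ⊕ Fin 2 → ℂ |
        w (Sum.inl 0) ^ n + w (Sum.inl 1) ^ n - 1 = 0 ∧
        w (Sum.inr 0) = MvPolynomial.eval ![w (Sum.inl 0), w (Sum.inl 1)] R} := by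
    ext w
    simp only [Set.mem_setOf_eq, hFdef, eval_fermat_rows]
    constructor
    · rintro ⟨h1, h2⟩
      exact ⟨by linear_combination h1, h2⟩
    · rintro ⟨h1, h2⟩
      exact ⟨by linear_combination h1, h2⟩
  obtain ⟨x, y, hxy, hRxy⟩ := hR
  have h := unprojectedDensityQuestion_monicCurve_polyFibre F hFm hFirr (by rw [hFdeg]; exact hn)
    le_rfl le_rfl hΦan hplace hdir R ⟨x, y, by rw [hFdef, eval_fermat_rows]; linear_combination hxy, hRxy⟩
  rw [e] at h
  exact h

end FermatCurve

/-! ## Examples -/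

/-- Example: the complex circle with the product fibre, `{x₀² + x₁² = 1, y₀ = x₀x₁}`: case ∧ dense.
[cite: MantovaMasser2023, §1 Further remarks, p. 5 (the question, open in general)] (new) -/
theorem unprojectedDensityQuestion_circle_fibre_x₀_mul_x₁ :
    MMCaseDimPiOneFree {w : Fin 2 ⊕ Fin 2 → ℂ |
        w (Sum.inl 0) ^ 2 + w (Sum.inl 1) ^ 2 - 1 = 0 ∧ w (Sum.inr 0) = w (Sum.inl 0) * w (Sum.inl 1)} ∧
      UnprojectedDense {w : Fin 2 ⊕ Fin 2 → ℂ |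
        w (Sum.inl 0) ^ 2 + w (Sum.inl 1) ^ 2 - 1 = 0 ∧ w (Sum.inr 0) = w (Sum.inl 0) * w (Sum.inl 1)} := by
  have e : {w : Fin 2 ⊕ Fin 2 → ℂ |
        w (Sum.inl 0) ^ 2 + w (Sum.inl 1) ^ 2 - 1 = 0 ∧
        w (Sum.inr 0) = MvPolynomial.eval ![w (Sum.inl 0), w (Sum.inl 1)]
          (MvPolynomial.X 0 * MvPolynomial.X 1 : MvPolynomial (Fin 2) ℂ)} =
      {w : Fin 2 ⊕ Fin 2 → ℂ |
        w (Sum.inl 0) ^ 2 + w (Sum.inl 1) ^ 2 - 1 = 0 ∧ w (Sum.inr 0) = w (Sum.inl 0) * w (Sum.inl 1)} := by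
    ext w
    simp
  have h := unprojectedDensityQuestion_fermatCurve_polyFibre 2 le_rfl
    (MvPolynomial.X 0 * MvPolynomial.X 1 : MvPolynomial (Fin 2) ℂ)
    ⟨3 / 5, 4 / 5, by norm_num, by simp⟩
  rw [e] at h
  exact h

/-- Example: `{x₀³ + x₁³ = 1, y₀ = x₀ + x₁}`: case ∧ dense.
[cite: MantovaMasser2023, §1 Further remarks, p. 5 (the question, open in general)] (new) -/
theorem unprojectedDensityQuestion_fermatCubicCurve_fibre_x₀_add_x₁ :
    MMCaseDimPiOneFree {w : Fin 2 ⊕ Fin 2 → ℂ |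
        w (Sum.inl 0) ^ 3 + w (Sum.inl 1) ^ 3 - 1 = 0 ∧ w (Sum.inr 0) = w (Sum.inl 0) + w (Sum.inl 1)} ∧
      UnprojectedDense {w : Fin 2 ⊕ Fin 2 → ℂ |
        w (Sum.inl 0) ^ 3 + w (Sum.inl 1) ^ 3 - 1 = 0 ∧ w (Sum.inr 0) = w (Sum.inl 0) + w (Sum.inl 1)} := by
  have e : {w : Fin 2 ⊕ Fin 2 → ℂ |
        w (Sum.inl 0) ^ 3 + w (Sum.inl 1) ^ 3 - 1 = 0 ∧
        w (Sum.inr 0) = MvPolynomial.eval ![w (Sum.inl 0), w (Sum.inl 1)]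
          (MvPolynomial.X 0 + MvPolynomial.X 1 : MvPolynomial (Fin 2) ℂ)} =
      {w : Fin 2 ⊕ Fin 2 → ℂ |
        w (Sum.inl 0) ^ 3 + w (Sum.inl 1) ^ 3 - 1 = 0 ∧ w (Sum.inr 0) = w (Sum.inl 0) + w (Sum.inl 1)} := by
    ext w
    simp
  have h := unprojectedDensityQuestion_fermatCurve_polyFibre 3 (by norm_num)
    (MvPolynomial.X 0 + MvPolynomial.X 1 : MvPolynomial (Fin 2) ℂ)
    ⟨1, 0, by norm_num, by simp⟩
  rw [e] at h
  exact h

/-! ## The genus-one base `x₁² − x₀²x₁ = 1` -/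

/-- **Every polynomial fibre over the genus-one curve `x₁² − x₀²x₁ = 1`: case ∧ dense** (`R`
nonzero somewhere on the curve; place `x₀ = 1/s`, `x₁ = Φ(s)/s²`, `Φ(0) = 1`, direction
`Re (2πi)² ≠ 0`). [cite: MantovaMasser2023, §1 Further remarks, p. 5 (the question, open in
general)] (new) -/
theorem unprojectedDensityQuestion_genusOne_polyFibre (R : MvPolynomial (Fin 2) ℂ)
    (hR : ∃ x y : ℂ, y ^ 2 - x ^ 2 * y - 1 = 0 ∧ MvPolynomial.eval ![x, y] R ≠ 0) :
    MMCaseDimPiOneFree {w : Fin 2 ⊕ Fin 2 → ℂ |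
        w (Sum.inl 1) ^ 2 - w (Sum.inl 0) ^ 2 * w (Sum.inl 1) - 1 = 0 ∧
        w (Sum.inr 0) = MvPolynomial.eval ![w (Sum.inl 0), w (Sum.inl 1)] R} ∧
      UnprojectedDense {w : Fin 2 ⊕ Fin 2 → ℂ |
        w (Sum.inl 1) ^ 2 - w (Sum.inl 0) ^ 2 * w (Sum.inl 1) - 1 = 0 ∧
        w (Sum.inr 0) = MvPolynomial.eval ![w (Sum.inl 0), w (Sum.inl 1)] R} := by
  set F : ℂ[X][X] := Polynomial.C (1 : ℂ[X]) * Polynomial.X ^ 2 +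
      Polynomial.C (-(Polynomial.X ^ 2) : ℂ[X]) * Polynomial.X + Polynomial.C (-1 : ℂ[X]) with hFdef
  have hFev : ∀ x y : ℂ, (F.map (Polynomial.evalRingHom x)).eval y = y ^ 2 - x ^ 2 * y - 1 := by
    intro x y
    rw [hFdef, evalPP_monicQuadratic]
    simp
    ring
  have hFm : F.Monic := by
    rw [hFdef]
    monicity!
  have hFdeg : F.natDegree = 2 := by
    rw [hFdef]
    compute_degree!
  have hFirr : Irreducible F := irreducible_genusOne_baseRow
  obtain ⟨Φ, hΦan, hΦ0, hΦ⟩ := genusOne_branch_facts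
  have hplace : ∀ᶠ s in 𝓝[≠] (0 : ℂ),
      (F.map (Polynomial.evalRingHom (s ^ 1)⁻¹)).eval (Φ s * (s ^ 2)⁻¹) = 0 := by
    filter_upwards [eventually_nhdsWithin_of_eventually_nhds hΦ, self_mem_nhdsWithin] with s hs hs0
    have hs0' : s ≠ 0 := hs0
    obtain ⟨-, hq⟩ := hs
    rw [hFev, pow_one]
    field_simp
    linear_combination hq
  have hdir : ∃ z : ℂ, z ^ 1 = 2 * Real.pi * I ∧ (Φ 0 * z ^ 2).re ≠ 0 := by
    refine ⟨2 * Real.pi * I, pow_one _, ?_⟩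
    rw [hΦ0, one_mul]
    have h : ((2 * Real.pi * I : ℂ) ^ 2).re = -(4 * Real.pi ^ 2) := by
      rw [show (2 * Real.pi * I : ℂ) ^ 2 = ((-(4 * Real.pi ^ 2) : ℝ) : ℂ) by
        push_cast; linear_combination (4 * (Real.pi : ℂ) ^ 2) * Complex.I_sq, Complex.ofReal_re]
    rw [h, neg_ne_zero]
    positivity
  have e : {w : Fin 2 ⊕ Fin 2 → ℂ |
        (F.map (Polynomial.evalRingHom (w (Sum.inl 0)))).eval (w (Sum.inl 1)) = 0 ∧
        w (Sum.inr 0) = MvPolynomial.eval ![w (Sum.inl 0), w (Sum.inl 1)] R} =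
      {w : Fin 2 ⊕ Fin 2 → ℂ |
        w (Sum.inl 1) ^ 2 - w (Sum.inl 0) ^ 2 * w (Sum.inl 1) - 1 = 0 ∧
        w (Sum.inr 0) = MvPolynomial.eval ![w (Sum.inl 0), w (Sum.inl 1)] R} := by
    ext w
    simp only [Set.mem_setOf_eq, hFev]
  obtain ⟨x, y, hxy, hRxy⟩ := hR
  have h := unprojectedDensityQuestion_monicCurve_polyFibre F hFm hFirr (by rw [hFdeg])
    le_rfl (by norm_num : 1 ≤ 2) hΦan hplace hdir R ⟨x, y, by rw [hFev]; exact hxy, hRxy⟩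
  rw [e] at h
  exact h

/-- Example: `{x₁² − x₀²x₁ = 1, y₀ = x₀x₁}`: case ∧ dense.
[cite: MantovaMasser2023, §1 Further remarks, p. 5 (the question, open in general)] (new) -/
theorem unprojectedDensityQuestion_genusOne_fibre_x₀_mul_x₁ :
    MMCaseDimPiOneFree {w : Fin 2 ⊕ Fin 2 → ℂ |
        w (Sum.inl 1) ^ 2 - w (Sum.inl 0) ^ 2 * w (Sum.inl 1) - 1 = 0 ∧
        w (Sum.inr 0) = w (Sum.inl 0) * w (Sum.inl 1)} ∧
      UnprojectedDense {w : Fin 2 ⊕ Fin 2 → ℂ |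
        w (Sum.inl 1) ^ 2 - w (Sum.inl 0) ^ 2 * w (Sum.inl 1) - 1 = 0 ∧
        w (Sum.inr 0) = w (Sum.inl 0) * w (Sum.inl 1)} := by
  have e : {w : Fin 2 ⊕ Fin 2 → ℂ |
        w (Sum.inl 1) ^ 2 - w (Sum.inl 0) ^ 2 * w (Sum.inl 1) - 1 = 0 ∧
        w (Sum.inr 0) = MvPolynomial.eval ![w (Sum.inl 0), w (Sum.inl 1)]
          (MvPolynomial.X 0 * MvPolynomial.X 1 : MvPolynomial (Fin 2) ℂ)} =
      {w : Fin 2 ⊕ Fin 2 → ℂ |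
        w (Sum.inl 1) ^ 2 - w (Sum.inl 0) ^ 2 * w (Sum.inl 1) - 1 = 0 ∧
        w (Sum.inr 0) = w (Sum.inl 0) * w (Sum.inl 1)} := by
    ext w
    simp
  -- over `x₀ = 1` the curve has the points `x₁` with `x₁² − x₁ − 1 = 0`, all nonzero
  have hp : (Polynomial.X ^ 2 - Polynomial.X - 1 : ℂ[X]).degree = 2 := by
    compute_degree!
  obtain ⟨y, hy⟩ := IsAlgClosed.exists_root (Polynomial.X ^ 2 - Polynomial.X - 1 : ℂ[X])
    (by rw [hp]; norm_num)
  have hy' : y ^ 2 - y - 1 = 0 := by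
    have := hy.eq_zero
    simpa using this
  have hy0 : y ≠ 0 := by
    rintro rfl
    norm_num at hy'
  have h := unprojectedDensityQuestion_genusOne_polyFibre
    (MvPolynomial.X 0 * MvPolynomial.X 1 : MvPolynomial (Fin 2) ℂ)
    ⟨1, y, by linear_combination hy', by simpa using hy0⟩
  rw [e] at h
  exact h

end Summit.Schanuel.Schanuel.Theorems

end
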